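import Mathlib
import Summits.QuantumFields.QCD.Theorems.QuarksAsStableActionUnquenchedChessboardBoundStubSitePeelDet
import HarnessLib

/-!
# The site-reflection peeling inequalities for the signed, bond-diluted partition function (stubs
`stub_torusPeel` and `stub_sitePeel` of crux stmt-QuantumFields-9735, line Sketch — wave-2 main file)

With `Zb(E) = ∫ ∏_f det D_E[U, m_f] e^{-β S_W(U)} ∏dU` the signed diluted partition function, the
abstract inequality `polar_main` (wave-2 helper 3b) at the fixed reflection planes `t = 0`, `t = L/2`
is specialised to

* `stub_torusPeel`: `A` = all bonds of the closed upper half (`slabBonds 0 (L/2)`), `B` = the spatial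
  bonds of the two planes: `A ∪ θA = univ`, `A ∪ θB = A`, `B ∪ θB = B`;
* `stub_sitePeel`: `A = slabBonds 0 p`, `B = sliceBonds 0` (`2p ≤ L/2`): `A ∪ θA = slabBonds (-p) (2p)`,
  `A ∪ θB = A`, `B ∪ θB = B`;

followed by the Cauchy–Schwarz extraction `cs_of_forall_quadratic`. The bond-set identities are
`ZMod L` time arithmetic (`tv`).
-/

noncomputable section

open Matrix Complex Finset MeasureTheory
open Literature.MathematicalPhysics.QuantumLattice Literature.MathematicalPhysics.QuantumFieldTheory
open Literature.Probability.LatticeModels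
open Summit.QuantumFields.QCD.Theorems.QuarksAsStableAction
open scoped ComplexConjugate BigOperators ComplexOrder

namespace Summit.QuantumFields.QCD.Theorems.UnquenchedChessboardBoundLine

/-! ## Time arithmetic of bonds and reflected bonds -/

section Time

variable {L : ℕ} [NeZero L] [Fact (1 < L)]

omit [NeZero L] [Fact (1 < L)] in
/-- `(x₀ - 0).val = tv x`. -/
theorem val_sub_zero_eq_tv (x : TorusSite 4 L) : (x 0 - 0).val = tv x := by
  rw [sub_zero]; rfl

omit [NeZero L] [Fact (1 < L)] in
/-- `x₀ = 0 ↔ tv x = 0`. -/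
theorem apply_zero_eq_zero_iff (x : TorusSite 4 L) : x 0 = 0 ↔ tv x = 0 :=
  (ZMod.val_eq_zero (x 0)).symm

omit [Fact (1 < L)] in
/-- `x₀ = n ↔ tv x = n` for `n < L`. -/
theorem apply_zero_eq_natCast_iff (x : TorusSite 4 L) {n : ℕ} (hn : n < L) : x 0 = (n : ZMod L) ↔ tv x = n := by
  constructor
  · intro h
    show (x 0).val = n
    rw [h, ZMod.val_cast_of_lt hn]
  · intro h
    apply ZMod.val_injective
    rw [ZMod.val_cast_of_lt hn]
    exact h

omit [Fact (1 < L)] in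
/-- `(x₀ + p).val` in terms of `tv x`, for `p < L`. -/
theorem val_sub_neg_natCast (x : TorusSite 4 L) {p : ℕ} (hp : p < L) :
    (x 0 - -(p : ZMod L)).val = if tv x + p < L then tv x + p else tv x + p - L := by
  rw [sub_neg_eq_add, ZMod.val_add, ZMod.val_cast_of_lt hp]
  change (tv x + p) % L = _
  have hx := tv_lt x
  split_ifs with h
  · exact Nat.mod_eq_of_lt h
  · rw [Nat.mod_eq_sub_mod (by omega), Nat.mod_eq_of_lt (by omega)]

/-- Time of the source of the reflected temporal bond: `tv θ(x + ê₀)`. -/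
theorem tv_siteTimeNeg_shift_zero (x : TorusSite 4 L) :
    tv (siteTimeNeg (Site.shift x 0)) = if tv x + 1 = L then 0 else L - (tv x + 1) := by
  rw [tv_siteTimeNeg, tv_shift_zero]
  by_cases h : tv x + 1 = L
  · simp [h]
  · simp only [h, if_false, Nat.add_eq_zero_iff, one_ne_zero, and_false]

omit [NeZero L] [Fact (1 < L)] in
/-- `θ(x + ê₀) + ê₀ = θ x`. -/
theorem shift_siteTimeNeg_shift (x : TorusSite 4 L) : Site.shift (siteTimeNeg (Site.shift x 0)) 0 = siteTimeNeg x :=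
  ((siteTimeNeg_eq_shift_iff x (Site.shift x 0)).2 rfl).symm

end Time

/-! ## The bond sets of the torus peeling -/

section Torus

variable {L : ℕ} [NeZero L] [Fact (1 < L)]

/-- The closed upper half consists of upper bonds. -/
theorem slabBonds_half_subset_upperBonds (hL : Even L) :
    slabBonds (0 : ZMod L) (L / 2) ⊆ upperBonds := by
  have hL' := Nat.even_iff.1 hL
  rintro ⟨x, μ⟩ hb
  rw [mem_slabBonds] at hb
  rw [mem_upperBonds]
  simp only [val_sub_zero_eq_tv] at hb ⊢
  have hx := tv_lt x
  by_cases hμ : μ = 0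
  · subst hμ
    rw [tv_shift_zero]
    have h2 : tv x < L / 2 := by
      rcases hb.2 with h | h
      · exact absurd rfl h
      · exact h
    split_ifs <;> omega
  · rw [tv_shift_ne _ hμ]
    exact ⟨hb.1, hb.1⟩

omit [Fact (1 < L)] in
/-- The plane bonds are upper bonds. -/
theorem sliceBonds_planes_subset_upperBonds (hL : Even L) (h4 : 4 ≤ L) :
    sliceBonds (0 : ZMod L) ∪ sliceBonds ((L / 2 : ℕ) : ZMod L) ⊆ upperBonds := by
  have hL' := Nat.even_iff.1 hL
  rintro ⟨x, μ⟩ hb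
  rw [Finset.mem_union, mem_sliceBonds, mem_sliceBonds] at hb
  rw [mem_upperBonds]
  simp only at hb ⊢
  rw [apply_zero_eq_zero_iff, apply_zero_eq_natCast_iff _ (by omega)] at hb
  have hμ : μ ≠ 0 := by rcases hb with h | h <;> exact h.2
  rw [tv_shift_ne _ hμ]
  rcases hb with h | h <;> omega

/-- The closed upper half and the two planes have the same plane bonds. -/
theorem planeBonds_slab_iff_slices (hL : Even L) (h4 : 4 ≤ L) :
    ∀ b ∈ (planeBonds : Finset (Edge 4 L)),
      b ∈ slabBonds (0 : ZMod L) (L / 2) ↔ b ∈ sliceBonds (0 : ZMod L) ∪ sliceBonds ((L / 2 : ℕ) : ZMod L) := by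
  have hL' := Nat.even_iff.1 hL
  rintro ⟨x, μ⟩ hb
  rw [mem_planeBonds] at hb
  rw [mem_slabBonds, Finset.mem_union, mem_sliceBonds, mem_sliceBonds]
  simp only [val_sub_zero_eq_tv] at hb ⊢
  rw [apply_zero_eq_zero_iff, apply_zero_eq_natCast_iff _ (by omega)]
  have hx := tv_lt x
  have hμ : μ ≠ 0 := by
    intro h0
    subst h0
    have e1 := tv_shift_zero x
    rcases hb with ⟨h1 | h1, h2 | h2⟩ <;> split_ifs at e1 <;> omega
  simp only [hμ, ne_eq, not_false_eq_true, true_or, and_true]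
  omega

/-- `A ∪ θA = univ` for the closed upper half. -/
theorem slab_union_reflBonds_slab (hL : Even L) (h4 : 4 ≤ L) :
    slabBonds (0 : ZMod L) (L / 2) ∪ reflBonds (slabBonds (0 : ZMod L) (L / 2)) = univ := by
  have hL' := Nat.even_iff.1 hL
  ext ⟨x, μ⟩
  simp only [Finset.mem_univ, iff_true, Finset.mem_union, mem_reflBonds, mem_slabBonds, val_sub_zero_eq_tv]
  have hx := tv_lt x
  unfold reflBond
  by_cases hμ : μ = 0
  · subst hμ
    simp only [if_true, tv_siteTimeNeg_shift_zero, ne_eq, not_true_eq_false, false_or]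
    split_ifs <;> omega
  · simp only [hμ, if_false, tv_siteTimeNeg, ne_eq, not_false_eq_true, true_or, and_true]
    split_ifs <;> omega

omit [Fact (1 < L)] in
/-- `A ∪ θB = A` for the closed upper half and the planes. -/
theorem slab_union_reflBonds_slices (hL : Even L) (h4 : 4 ≤ L) :
    slabBonds (0 : ZMod L) (L / 2) ∪ reflBonds (sliceBonds (0 : ZMod L) ∪ sliceBonds ((L / 2 : ℕ) : ZMod L)) =
      slabBonds (0 : ZMod L) (L / 2) := by
  have hL' := Nat.even_iff.1 hL
  ext ⟨x, μ⟩
  simp only [Finset.mem_union, mem_reflBonds, mem_slabBonds, mem_sliceBonds, val_sub_zero_eq_tv]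
  have hx := tv_lt x
  unfold reflBond
  by_cases hμ : μ = 0
  · subst hμ
    simp only [if_true, ne_eq, not_true_eq_false, and_false, or_false]
  · simp only [hμ, if_false, ne_eq, not_false_eq_true, and_true, true_or]
    rw [apply_zero_eq_zero_iff, apply_zero_eq_natCast_iff _ (by omega), tv_siteTimeNeg]
    split_ifs <;> omega

omit [Fact (1 < L)] in
/-- `B ∪ θB = B` for the planes. -/
theorem slices_union_reflBonds_slices (hL : Even L) (h4 : 4 ≤ L) :
    (sliceBonds (0 : ZMod L) ∪ sliceBonds ((L / 2 : ℕ) : ZMod L)) ∪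
        reflBonds (sliceBonds (0 : ZMod L) ∪ sliceBonds ((L / 2 : ℕ) : ZMod L)) =
      sliceBonds (0 : ZMod L) ∪ sliceBonds ((L / 2 : ℕ) : ZMod L) := by
  have hL' := Nat.even_iff.1 hL
  ext ⟨x, μ⟩
  simp only [Finset.mem_union, mem_reflBonds, mem_sliceBonds]
  have hx := tv_lt x
  unfold reflBond
  by_cases hμ : μ = 0
  · subst hμ
    simp only [if_true, ne_eq, not_true_eq_false, and_false, or_false]
  · simp only [hμ, if_false, ne_eq, not_false_eq_true, and_true]
    rw [apply_zero_eq_zero_iff, apply_zero_eq_natCast_iff _ (by omega), apply_zero_eq_zero_iff,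
      apply_zero_eq_natCast_iff _ (by omega), tv_siteTimeNeg]
    split_ifs <;> omega

end Torus

/-! ## The bond sets of the slab peeling -/

section Slab

variable {L : ℕ} [NeZero L] [Fact (1 < L)]

/-- A short upper slab consists of upper bonds. -/
theorem slabBonds_subset_upperBonds (hL : Even L) (h4 : 4 ≤ L) {p : ℕ} (hp : 2 * p ≤ L / 2) :
    slabBonds (0 : ZMod L) p ⊆ upperBonds := by
  have hL' := Nat.even_iff.1 hL
  rintro ⟨x, μ⟩ hb
  rw [mem_slabBonds] at hb
  rw [mem_upperBonds]
  simp only [val_sub_zero_eq_tv] at hb ⊢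
  have hx := tv_lt x
  by_cases hμ : μ = 0
  · subst hμ
    rw [tv_shift_zero]
    have h2 : tv x < p := by
      rcases hb.2 with h | h
      · exact absurd rfl h
      · exact h
    split_ifs <;> omega
  · rw [tv_shift_ne _ hμ]
    omega

omit [Fact (1 < L)] in
/-- The slice `t = 0` consists of upper bonds. -/
theorem sliceBonds_zero_subset_upperBonds : sliceBonds (0 : ZMod L) ⊆ upperBonds := by
  rintro ⟨x, μ⟩ hb
  rw [mem_sliceBonds] at hb
  rw [mem_upperBonds]
  simp only at hb ⊢
  rw [apply_zero_eq_zero_iff] at hb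
  rw [tv_shift_ne _ hb.2]
  omega

/-- A short upper slab and the slice `t = 0` have the same plane bonds. -/
theorem planeBonds_slab_iff_slice (hL : Even L) (h4 : 4 ≤ L) {p : ℕ} (hp : 2 * p ≤ L / 2) :
    ∀ b ∈ (planeBonds : Finset (Edge 4 L)), b ∈ slabBonds (0 : ZMod L) p ↔ b ∈ sliceBonds (0 : ZMod L) := by
  have hL' := Nat.even_iff.1 hL
  rintro ⟨x, μ⟩ hb
  rw [mem_planeBonds] at hb
  rw [mem_slabBonds, mem_sliceBonds]
  simp only [val_sub_zero_eq_tv] at hb ⊢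
  rw [apply_zero_eq_zero_iff]
  have hx := tv_lt x
  have hμ : μ ≠ 0 := by
    intro h0
    subst h0
    have e1 := tv_shift_zero x
    rcases hb with ⟨h1 | h1, h2 | h2⟩ <;> split_ifs at e1 <;> omega
  simp only [hμ, ne_eq, not_false_eq_true, true_or, and_true]
  omega

/-- `A ∪ θA = slabBonds (-p) (2p)` for the short upper slab. -/
theorem slab_union_reflBonds_slab_eq (hL : Even L) (h4 : 4 ≤ L) {p : ℕ} (hp : 2 * p ≤ L / 2) :
    slabBonds (0 : ZMod L) p ∪ reflBonds (slabBonds (0 : ZMod L) p) = slabBonds (-(p : ZMod L)) (2 * p) := by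
  have hL' := Nat.even_iff.1 hL
  ext ⟨x, μ⟩
  simp only [Finset.mem_union, mem_reflBonds, mem_slabBonds, val_sub_zero_eq_tv]
  have hx := tv_lt x
  rw [val_sub_neg_natCast _ (by omega)]
  unfold reflBond
  by_cases hμ : μ = 0
  · subst hμ
    simp only [if_true, tv_siteTimeNeg_shift_zero, ne_eq, not_true_eq_false, false_or]
    split_ifs <;> omega
  · simp only [hμ, if_false, tv_siteTimeNeg, ne_eq, not_false_eq_true, true_or, and_true]
    split_ifs <;> omega

omit [Fact (1 < L)] in
/-- `A ∪ θB = A` for the short upper slab and the slice `t = 0`. -/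
theorem slab_union_reflBonds_slice (hL : Even L) (p : ℕ) :
    slabBonds (0 : ZMod L) p ∪ reflBonds (sliceBonds (0 : ZMod L)) = slabBonds (0 : ZMod L) p := by
  have hL' := Nat.even_iff.1 hL
  ext ⟨x, μ⟩
  simp only [Finset.mem_union, mem_reflBonds, mem_slabBonds, mem_sliceBonds, val_sub_zero_eq_tv]
  have hx := tv_lt x
  unfold reflBond
  by_cases hμ : μ = 0
  · subst hμ
    simp only [if_true, ne_eq, not_true_eq_false, and_false, or_false]
  · simp only [hμ, if_false, ne_eq, not_false_eq_true, and_true, true_or]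
    rw [apply_zero_eq_zero_iff, tv_siteTimeNeg]
    split_ifs <;> omega

omit [Fact (1 < L)] in
/-- `B ∪ θB = B` for the slice `t = 0`. -/
theorem slice_union_reflBonds_slice :
    sliceBonds (0 : ZMod L) ∪ reflBonds (sliceBonds (0 : ZMod L)) = sliceBonds (0 : ZMod L) := by
  ext ⟨x, μ⟩
  simp only [Finset.mem_union, mem_reflBonds, mem_sliceBonds]
  have hx := tv_lt x
  unfold reflBond
  by_cases hμ : μ = 0
  · subst hμ
    simp only [if_true, ne_eq, not_true_eq_false, and_false, or_false]
  · simp only [hμ, if_false, ne_eq, not_false_eq_true, and_true]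
    rw [apply_zero_eq_zero_iff, apply_zero_eq_zero_iff, tv_siteTimeNeg]
    split_ifs <;> omega

end Slab

/-! ## The stubs -/

/-- **Stub `torusPeel`** (site reflection `t ↦ -t` in the planes `t = 0`, `t = L/2`; Cauchy–Schwarz
of the polarized Gram identity for the diluted determinant): `0 ≤ Re Zb(univ)` and
`‖Zb(slab[0, L/2])‖² ≤ Re Zb(univ) · Re Zb(slice 0 ∪ slice L/2)`. -/
theorem stub_torusPeel (Nf L : ℕ) [NeZero L] [Fact (1 < L)] (hL : Even L) (h4 : 4 ≤ L) (β : ℝ)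
    (m : Fin Nf → ℝ) (hm : ∀ f, -1 < m f) :
    0 ≤ (∫ U, (∏ f, (bondWilsonDiracAP univ U (m f)).det) *
            (Real.exp (-β * wilsonAction (fundamentalRep (Fin 3)) U) : ℂ)
          ∂(Measure.pi fun _ : Edge 4 L => haarProbability (Matrix.specialUnitaryGroup (Fin 3) ℂ))).re ∧
      ‖∫ U, (∏ f, (bondWilsonDiracAP (slabBonds 0 (L / 2)) U (m f)).det) *
            (Real.exp (-β * wilsonAction (fundamentalRep (Fin 3)) U) : ℂ)
          ∂(Measure.pi fun _ : Edge 4 L => haarProbability (Matrix.specialUnitaryGroup (Fin 3) ℂ))‖ ^ 2 ≤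
        (∫ U, (∏ f, (bondWilsonDiracAP univ U (m f)).det) *
            (Real.exp (-β * wilsonAction (fundamentalRep (Fin 3)) U) : ℂ)
          ∂(Measure.pi fun _ : Edge 4 L => haarProbability (Matrix.specialUnitaryGroup (Fin 3) ℂ))).re *
        (∫ U, (∏ f, (bondWilsonDiracAP (sliceBonds 0 ∪ sliceBonds ((L / 2 : ℕ) : ZMod L)) U (m f)).det) *
            (Real.exp (-β * wilsonAction (fundamentalRep (Fin 3)) U) : ℂ)
          ∂(Measure.pi fun _ : Edge 4 L => haarProbability (Matrix.specialUnitaryGroup (Fin 3) ℂ))).re := by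
  have hA := slabBonds_half_subset_upperBonds (L := L) hL
  have hB := sliceBonds_planes_subset_upperBonds (L := L) hL h4
  have hAB := planeBonds_slab_iff_slices (L := L) hL h4
  have h1 := fun t => polar_main hL h4 β m hm hA hB hAB t
  have h2 := polar_main hL h4 β m hm hB hA (fun b hb => (hAB b hb).symm) 0
  simp only [map_zero, zero_mul, add_zero, slices_union_reflBonds_slices hL h4] at h2
  simp only [slab_union_reflBonds_slab hL h4, slab_union_reflBonds_slices hL h4,
    slices_union_reflBonds_slices hL h4] at h1
  exact cs_of_forall_quadratic h1 h2

/-- **Stub `sitePeel`** (site reflection `t ↦ -t` in the planes `t = 0`, `t = L/2`): the closed slab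
of the slices `-p, …, p` (even length `2p ≤ L/2`), its upper half `0, …, p` and the middle slice `0`
satisfy `0 ≤ Re Zb(slab[-p, p])` and `‖Zb(slab[0, p])‖² ≤ Re Zb(slab[-p, p]) · Re Zb(slice 0)`. -/
theorem stub_sitePeel (Nf L : ℕ) [NeZero L] [Fact (1 < L)] (hL : Even L) (h4 : 4 ≤ L) (β : ℝ)
    (m : Fin Nf → ℝ) (hm : ∀ f, -1 < m f) (p : ℕ) (hp : 2 * p ≤ L / 2) :
    0 ≤ (∫ U, (∏ f, (bondWilsonDiracAP (slabBonds (-(p : ZMod L)) (2 * p)) U (m f)).det) *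
            (Real.exp (-β * wilsonAction (fundamentalRep (Fin 3)) U) : ℂ)
          ∂(Measure.pi fun _ : Edge 4 L => haarProbability (Matrix.specialUnitaryGroup (Fin 3) ℂ))).re ∧
      ‖∫ U, (∏ f, (bondWilsonDiracAP (slabBonds 0 p) U (m f)).det) *
            (Real.exp (-β * wilsonAction (fundamentalRep (Fin 3)) U) : ℂ)
          ∂(Measure.pi fun _ : Edge 4 L => haarProbability (Matrix.specialUnitaryGroup (Fin 3) ℂ))‖ ^ 2 ≤
        (∫ U, (∏ f, (bondWilsonDiracAP (slabBonds (-(p : ZMod L)) (2 * p)) U (m f)).det) *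
            (Real.exp (-β * wilsonAction (fundamentalRep (Fin 3)) U) : ℂ)
          ∂(Measure.pi fun _ : Edge 4 L => haarProbability (Matrix.specialUnitaryGroup (Fin 3) ℂ))).re *
        (∫ U, (∏ f, (bondWilsonDiracAP (sliceBonds 0) U (m f)).det) *
            (Real.exp (-β * wilsonAction (fundamentalRep (Fin 3)) U) : ℂ)
          ∂(Measure.pi fun _ : Edge 4 L => haarProbability (Matrix.specialUnitaryGroup (Fin 3) ℂ))).re := by
  have hA := slabBonds_subset_upperBonds (L := L) hL h4 hp
  have hB := sliceBonds_zero_subset_upperBonds (L := L)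
  have hAB := planeBonds_slab_iff_slice (L := L) hL h4 hp
  have h1 := fun t => polar_main hL h4 β m hm hA hB hAB t
  have h2 := polar_main hL h4 β m hm hB hA (fun b hb => (hAB b hb).symm) 0
  simp only [map_zero, zero_mul, add_zero, slice_union_reflBonds_slice] at h2
  simp only [slab_union_reflBonds_slab_eq hL h4 hp, slab_union_reflBonds_slice hL p,
    slice_union_reflBonds_slice] at h1
  exact cs_of_forall_quadratic h1 h2

end Summit.QuantumFields.QCD.Theorems.UnquenchedChessboardBoundLine

end
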